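import Summits.AtomisticToContinuum.Crystallization.Theorems.FrustratedLawDichotomyPeriodicBlockGeometry

/-!
# FrustratedLawDichotomy · crux `AperiodicFrustratedLawGap` (stmt-AtomisticToContinuum-27623) — PERIODIC-BLOCK NEGATIVE KERNEL, part B:
# the blocks of a periodic cell, their separation, interior neighbourhoods and exact interior site sums
# (decomp-a2c, prover hand 2, structural share, generation 15; critic rows 544 (C) / 548 / 550)

A PERIODIC CELL is given by concrete data: motif `x : Fin N₀ → ℝ³`, cell basis `a : Fin 3 → ℝ³` with a dual basis `b` (`⟪b_j, a_k⟫ = δ_jk`,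
`‖b_j‖ ≤ cB`), the periodic separation `PerSep x a` (`7/10 ≤ |x_m − x_m′ − latVec a s|` unless `(m, s) = (m′, 0)`), and a SUPERCELL MOTIF
enumeration `(μ, σ) : Fin M → Fin N₀ × ℤ³` of all `(m, s)` with `|s|_∞ ≤ k₀` (`superMotif x a μ σ q = x (μ q) + latVec a (σ q)`), with the
class centres `cidx m ↦ (m, 0)`.  The `n`-BLOCK is `block x a n (m, t) = x m + latVec a t`, `t ∈ {0,…,n−1}³`.

* §1 `block`, `block_sep` / `block_injective` (from `PerSep`);
* §2 interior translations `t` (`k₀ ≤ t_k ≤ n − 1 − k₀`): the translated supercell motif `superMotif + latVec a t` lies in the block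
  (`superMotif_add_mem_range_block`) and contains every block atom within `ϱ` of `x_m + latVec a t` as soon as `cB·(ϱ + diam x) < k₀ + 1`
  (`mem_range_superMotif_add_of_dist_le`) — the sub-configuration hypotheses of `…PeriodicBlockGeometry.goodAt_of_subconfig`;
* §3 ★ `siteSum_block_eq` — for `W` vanishing from `R ≤ ϱ` on, the block site sum of an interior site of class `m` is EXACTLY the periodic
  site sum `Σ_q W(|x_m − superMotif q|)`; `siteSum_le_of_sep` — every site sum of a `7/10`-separated configuration is at most
  `W 0 + (20R/7 + 1)³·Wsup`;
* §4 ★ `goodAt_block_of_superMotif` / `not_goodAt_block_of_superMotif` — interior flags from the certified flags of the supercell motif.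

Part C (`…PeriodicBlockViolation`) counts interior/boundary sites and assembles the violation `¬ (Σ level ≤ U_W − A·N)` for `n ≫ β/δ`.
All `[folklore]`; 0 sorry.
-/

noncomputable section

namespace Summit.AtomisticToContinuum.Crystallization.Theorems.FrustratedLawDichotomyPeriodicBlockKernel

open scoped BigOperators Classical
open Metric
open Literature.MathematicalPhysics.StatisticalMechanics (interactionEnergy lennardJones card_le_of_separated_of_dist_le)
open Summit.AtomisticToContinuum.Crystallization.Theorems.ChargedEnergyGapNegative (E3)
open Summit.AtomisticToContinuum.Crystallization.Theorems.FrustratedLawDichotomyRangeCut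
open Summit.AtomisticToContinuum.Crystallization.Theorems.FrustratedLawDichotomyMotifLemmas (GoodAtScale)
open Summit.AtomisticToContinuum.Crystallization.Theorems.FrustratedLawDichotomyMotifDoorE (MaybeGoodAt)
open Summit.AtomisticToContinuum.Crystallization.Theorems.FrustratedLawDichotomyPeriodicBlockGeometry

/-! ## §1. The block configuration of a periodic cell -/

/-- Integer coordinates of a block translation `t ∈ {0,…,n−1}³`. -/
def tvec {n : ℕ} (t : Fin 3 → Fin n) : Fin 3 → ℤ := fun k => ((t k : ℕ) : ℤ)

/-- `tvec` is injective. [folklore] -/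
theorem tvec_injective {n : ℕ} : Function.Injective (tvec (n := n)) := by
  intro t t' h
  funext k
  have := congrFun h k
  simp only [tvec, Nat.cast_inj] at this
  exact Fin.ext this

/-- **The `n`-block** of the cell `(x, a)`: `(m, t) ↦ x m + latVec a t`. -/
def block {N₀ : ℕ} (x : Fin N₀ → E3) (a : Fin 3 → E3) (n : ℕ) : Fin N₀ × (Fin 3 → Fin n) → E3 :=
  fun p => x p.1 + latVec a (tvec p.2)

/-- **Periodic separation** of the cell: distinct atoms of the infinite periodic configuration are `≥ 7/10` apart. -/
def PerSep {N₀ : ℕ} (x : Fin N₀ → E3) (a : Fin 3 → E3) : Prop :=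
  ∀ (m m' : Fin N₀) (s : Fin 3 → ℤ), (m ≠ m' ∨ s ≠ 0) → (7 : ℝ) / 10 ≤ dist (x m) (x m' + latVec a s)

/-- Distances in the periodic configuration only depend on the relative translation. [folklore] -/
theorem dist_translate {N₀ : ℕ} (x : Fin N₀ → E3) (a : Fin 3 → E3) (m m' : Fin N₀) (s s' : Fin 3 → ℤ) :
    dist (x m + latVec a s) (x m' + latVec a s') = dist (x m) (x m' + latVec a (s' - s)) := by
  rw [latVec_sub, ← dist_add_right (x m) (x m' + (latVec a s' - latVec a s)) (latVec a s)]
  congr 1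
  abel

/-- ★ **Blocks are `7/10`-separated.** [folklore] -/
theorem block_sep {N₀ : ℕ} {x : Fin N₀ → E3} {a : Fin 3 → E3} (hsep : PerSep x a) (n : ℕ) :
    ∀ p q : Fin N₀ × (Fin 3 → Fin n), p ≠ q → (7 : ℝ) / 10 ≤ dist (block x a n p) (block x a n q) := by
  rintro ⟨m, t⟩ ⟨m', t'⟩ hpq
  simp only [block]
  rw [dist_translate]
  refine hsep m m' _ ?_
  by_cases hm : m = m'
  · right
    intro hs
    apply hpq
    have ht : t = t' := tvec_injective (eq_of_sub_eq_zero hs).symm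
    rw [hm, ht]
  · exact Or.inl hm

/-- Blocks are injective. [folklore] -/
theorem block_injective {N₀ : ℕ} {x : Fin N₀ → E3} {a : Fin 3 → E3} (hsep : PerSep x a) (n : ℕ) :
    Function.Injective (block x a n) := by
  intro p q h
  by_contra hne
  have := block_sep hsep n p q hne
  rw [h, dist_self] at this
  linarith

/-! ## §2. The supercell motif and the interior translations -/

/-- **The supercell motif** enumerated by `(μ, σ)`: `q ↦ x (μ q) + latVec a (σ q)`. -/
def superMotif {N₀ M : ℕ} (x : Fin N₀ → E3) (a : Fin 3 → E3) (μ : Fin M → Fin N₀) (σ : Fin M → Fin 3 → ℤ) : Fin M → E3 :=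
  fun q => x (μ q) + latVec a (σ q)

/-- The supercell motif is injective when the labels are (from `PerSep`). [folklore] -/
theorem superMotif_injective {N₀ M : ℕ} {x : Fin N₀ → E3} {a : Fin 3 → E3} (hsep : PerSep x a) {μ : Fin M → Fin N₀}
    {σ : Fin M → Fin 3 → ℤ} (hμσ : Function.Injective fun q => (μ q, σ q)) : Function.Injective (superMotif x a μ σ) := by
  intro q q' h
  by_contra hne
  have hlab : μ q ≠ μ q' ∨ σ q' - σ q ≠ 0 := by
    by_contra hc
    push Not at hc
    apply hne
    apply hμσ
    simp only [Prod.mk.injEq]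
    exact ⟨hc.1, (eq_of_sub_eq_zero hc.2).symm⟩
  have h7 := hsep (μ q) (μ q') (σ q' - σ q) hlab
  rw [← dist_translate, ← superMotif, ← superMotif] at h7
  change (7 : ℝ) / 10 ≤ dist (superMotif x a μ σ q) (superMotif x a μ σ q') at h7
  rw [h, dist_self] at h7
  linarith

/-- **Interior translation** at depth `k₀`: `k₀ ≤ t_k` and `t_k + k₀ + 1 ≤ n` for all `k`. -/
def Interior (k₀ n : ℕ) (t : Fin 3 → Fin n) : Prop := ∀ k, k₀ ≤ (t k : ℕ) ∧ (t k : ℕ) + k₀ + 1 ≤ n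

/-- For an interior `t` and an offset `|s|_∞ ≤ k₀`, `t + s` is again a block translation. [folklore] -/
theorem exists_shift {k₀ n : ℕ} {t : Fin 3 → Fin n} (ht : Interior k₀ n t) {s : Fin 3 → ℤ} (hs : ∀ k, |s k| ≤ k₀) :
    ∃ t' : Fin 3 → Fin n, tvec t' = tvec t + s := by
  have hk : ∀ k, 0 ≤ tvec t k + s k ∧ tvec t k + s k < n := by
    intro k
    obtain ⟨h1, h2⟩ := ht k
    have hs1 := (abs_le.1 (hs k)).1
    have hs2 := (abs_le.1 (hs k)).2
    simp only [tvec]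
    constructor <;> omega
  refine ⟨fun k => ⟨(tvec t k + s k).toNat, ?_⟩, ?_⟩
  · have := (hk k).2
    have h0 := (hk k).1
    omega
  · funext k
    have h0 := (hk k).1
    simp only [tvec, Pi.add_apply] at h0 ⊢
    exact Int.toNat_of_nonneg h0

/-- ★ **The translated supercell motif lies in the block**: for interior `t` (depth `k₀`) and `|σ q|_∞ ≤ k₀`,
`superMotif q + latVec a t ∈ range (block x a n)`. [folklore] -/
theorem superMotif_add_mem_range_block {N₀ M k₀ n : ℕ} (x : Fin N₀ → E3) (a : Fin 3 → E3) {μ : Fin M → Fin N₀}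
    {σ : Fin M → Fin 3 → ℤ} (hσ : ∀ q k, |σ q k| ≤ k₀) {t : Fin 3 → Fin n} (ht : Interior k₀ n t) (q : Fin M) :
    superMotif x a μ σ q + latVec a (tvec t) ∈ Set.range (block x a n) := by
  obtain ⟨t', ht'⟩ := exists_shift ht (hσ q)
  refine ⟨(μ q, t'), ?_⟩
  simp only [block, superMotif, ht', latVec_add]
  abel

/-- The diameter bound of the motif. -/
def DiamLE {N₀ : ℕ} (x : Fin N₀ → E3) (diam : ℝ) : Prop := ∀ m m' : Fin N₀, ‖x m - x m'‖ ≤ diam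

/-- ★ **Every block atom within `ϱ` of an interior site lies in the translated supercell motif**: if `⟪b_j, a_k⟫ = δ_jk`, `‖b_j‖ ≤ cB`,
`cB·(ϱ + diam) < k₀ + 1`, every `(m′, s)` with `|s|_∞ ≤ k₀` is enumerated, and `t` is interior, then
`dist (block (m′, t′)) (x m + latVec a t) ≤ ϱ ⟹ block (m′, t′) ∈ range (superMotif + latVec a t)`. [folklore] -/
theorem mem_range_superMotif_add_of_dist_le {N₀ M k₀ n : ℕ} {x : Fin N₀ → E3} {a b : Fin 3 → E3} {cB ϱ diam : ℝ}
    (hdual : ∀ j k, inner ℝ (b j) (a k) = if j = k then (1 : ℝ) else 0) (hb : ∀ j, ‖b j‖ ≤ cB) (hdiam : DiamLE x diam)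
    (hk₀ : cB * (ϱ + diam) < k₀ + 1) {μ : Fin M → Fin N₀} {σ : Fin M → Fin 3 → ℤ}
    (hsup : ∀ (m : Fin N₀) (s : Fin 3 → ℤ), (∀ k, |s k| ≤ k₀) → ∃ q, μ q = m ∧ σ q = s)
    {t : Fin 3 → Fin n} (m : Fin N₀) {p : Fin N₀ × (Fin 3 → Fin n)}
    (hp : dist (block x a n p) (x m + latVec a (tvec t)) ≤ ϱ) :
    block x a n p ∈ Set.range (fun q => superMotif x a μ σ q + latVec a (tvec t)) := by
  obtain ⟨m', t'⟩ := p
  set s : Fin 3 → ℤ := tvec t' - tvec t with hs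
  -- the relative translation is short
  have hcB : 0 ≤ cB := (norm_nonneg _).trans (hb 0)
  have hnorm : ‖latVec a s‖ ≤ ϱ + diam := by
    have h1 : dist (block x a n (m', t')) (x m + latVec a (tvec t)) = ‖(x m' - x m) + latVec a s‖ := by
      simp only [block, dist_eq_norm, hs, latVec_sub]
      congr 1
      abel
    rw [h1] at hp
    have h2 : ‖latVec a s‖ ≤ ‖(x m' - x m) + latVec a s‖ + ‖x m' - x m‖ := by
      have := norm_sub_le ((x m' - x m) + latVec a s) (x m' - x m)
      rwa [add_sub_cancel_left] at this
    linarith [hdiam m' m]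
  have hsk : ∀ k, |s k| ≤ k₀ := by
    intro k
    have h1 := abs_coord_le_of_dual' hdual hb s k
    have h2 : |((s k : ℤ) : ℝ)| < k₀ + 1 := by
      calc |((s k : ℤ) : ℝ)| ≤ cB * ‖latVec a s‖ := h1
        _ ≤ cB * (ϱ + diam) := mul_le_mul_of_nonneg_left hnorm hcB
        _ < k₀ + 1 := hk₀
    have h3 : |s k| < (k₀ : ℤ) + 1 := by
      have : ((|s k| : ℤ) : ℝ) < (k₀ : ℝ) + 1 := by rw [Int.cast_abs]; exact h2
      exact_mod_cast this
    omega
  obtain ⟨q, hq1, hq2⟩ := hsup m' s hsk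
  refine ⟨q, ?_⟩
  simp only [superMotif, block, hq1, hq2, hs, latVec_sub]
  abel

/-- The centre of class `m` in the translated supercell motif is the block site `(m, t)`. [folklore] -/
theorem superMotif_centre {N₀ M n : ℕ} (x : Fin N₀ → E3) (a : Fin 3 → E3) {μ : Fin M → Fin N₀} {σ : Fin M → Fin 3 → ℤ}
    {cidx : Fin N₀ → Fin M} (hc : ∀ m, μ (cidx m) = m ∧ σ (cidx m) = 0) (m : Fin N₀) (t : Fin 3 → Fin n) :
    superMotif x a μ σ (cidx m) + latVec a (tvec t) = block x a n (m, t) := by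
  simp only [superMotif, block, (hc m).1, (hc m).2, latVec_zero, add_zero]

/-! ## §3. Site sums: exact in the interior, bounded everywhere -/

/-- ★ **EXACT INTERIOR SITE SUM**: for `W` vanishing from `R ≤ ϱ` on and an interior site `(m, t)`,
`Σ_{p ∈ block} W(|block (m,t) − block p|) = Σ_q W(|x m − superMotif q|)`. [folklore] -/
theorem siteSum_block_eq {N₀ M k₀ n : ℕ} {x : Fin N₀ → E3} {a b : Fin 3 → E3} {cB ϱ diam R : ℝ} {W : ℝ → ℝ}
    (hsep : PerSep x a) (hdual : ∀ j k, inner ℝ (b j) (a k) = if j = k then (1 : ℝ) else 0) (hb : ∀ j, ‖b j‖ ≤ cB)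
    (hdiam : DiamLE x diam) (hk₀ : cB * (ϱ + diam) < k₀ + 1) {μ : Fin M → Fin N₀} {σ : Fin M → Fin 3 → ℤ}
    (hμσ : Function.Injective fun q => (μ q, σ q)) (hσ : ∀ q k, |σ q k| ≤ k₀)
    (hsup : ∀ (m : Fin N₀) (s : Fin 3 → ℤ), (∀ k, |s k| ≤ k₀) → ∃ q, μ q = m ∧ σ q = s)
    (hW : ∀ r, R ≤ r → W r = 0) (hRϱ : R ≤ ϱ) {t : Fin 3 → Fin n} (ht : Interior k₀ n t) (m : Fin N₀) :
    ∑ p, W (dist (block x a n (m, t)) (block x a n p)) = ∑ q, W (dist (x m) (superMotif x a μ σ q)) := by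
  -- the embedding of the translated supercell motif into the block
  have hmem := fun q => superMotif_add_mem_range_block x a (μ := μ) hσ ht q
  choose ψ hψ using hmem
  have hψinj : Function.Injective ψ := by
    intro q q' h
    have := hψ q
    rw [h, hψ q'] at this
    exact (superMotif_injective hsep hμσ (add_right_cancel this)).symm
  -- outside the image of `ψ` the terms vanish
  have hcentre : block x a n (m, t) = x m + latVec a (tvec t) := rfl
  have hzero : ∀ p ∈ (Finset.univ : Finset (Fin N₀ × (Fin 3 → Fin n))), p ∉ Finset.univ.image ψ →
      W (dist (block x a n (m, t)) (block x a n p)) = 0 := by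
    intro p _ hp
    apply hW
    by_contra hlt
    push Not at hlt
    have hle : dist (block x a n p) (x m + latVec a (tvec t)) ≤ ϱ := by
      rw [dist_comm, ← hcentre]; linarith
    obtain ⟨q, hq⟩ := mem_range_superMotif_add_of_dist_le hdual hb hdiam hk₀ hsup m hle
    exact hp (Finset.mem_image.2 ⟨q, Finset.mem_univ _, block_injective hsep n (by rw [hψ q]; exact hq)⟩)
  rw [← Finset.sum_subset (Finset.subset_univ (Finset.univ.image ψ)) hzero, Finset.sum_image fun q _ q' _ h => hψinj h]
  refine Finset.sum_congr rfl fun q _ => ?_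
  rw [hψ q, hcentre, dist_comm, dist_add_right, dist_comm]

/-- **SITE SUMS ARE BOUNDED on `7/10`-separated configurations**: `W ≤ Wsup` on `[7/10, ∞)`, `Wsup ≥ 0`, `W` vanishing from `R ≥ 0` on ⟹
`Σ_q W(|Y p − Y q|) ≤ W 0 + (20R/7 + 1)³·Wsup` (packing count of the other atoms within `R`). [folklore] -/
theorem siteSum_le_of_sep {ι : Type*} [Fintype ι] {Y : ι → E3} (hY : Function.Injective Y)
    (hsep : ∀ p q : ι, p ≠ q → (7 : ℝ) / 10 ≤ dist (Y p) (Y q)) {W : ℝ → ℝ} {R Wsup : ℝ} (hR : 0 ≤ R)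
    (hW : ∀ r, R ≤ r → W r = 0) (hWle : ∀ r, (7 : ℝ) / 10 ≤ r → W r ≤ Wsup) (hWsup : 0 ≤ Wsup) (p : ι) :
    ∑ q, W (dist (Y p) (Y q)) ≤ W 0 + (20 * R / 7 + 1) ^ 3 * Wsup := by
  set S : Finset ι := Finset.univ.filter (fun q => q ≠ p ∧ dist (Y q) (Y p) ≤ R) with hS
  have hsplit : ∑ q, W (dist (Y p) (Y q)) = W (dist (Y p) (Y p)) + ∑ q ∈ Finset.univ.erase p, W (dist (Y p) (Y q)) :=
    (Finset.add_sum_erase _ _ (Finset.mem_univ p)).symm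
  rw [hsplit, dist_self]
  have hrest : ∑ q ∈ Finset.univ.erase p, W (dist (Y p) (Y q)) = ∑ q ∈ S, W (dist (Y p) (Y q)) := by
    refine (Finset.sum_subset ?_ ?_).symm
    · intro q hq
      rw [hS, Finset.mem_filter] at hq
      exact Finset.mem_erase.2 ⟨hq.2.1, Finset.mem_univ _⟩
    · intro q hq hqS
      have hne : q ≠ p := (Finset.mem_erase.1 hq).1
      have : ¬ dist (Y q) (Y p) ≤ R := fun h => hqS (by rw [hS, Finset.mem_filter]; exact ⟨Finset.mem_univ _, hne, h⟩)
      rw [dist_comm] at this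
      exact hW _ (le_of_not_ge this)
  rw [hrest]
  have hterm : ∀ q ∈ S, W (dist (Y p) (Y q)) ≤ Wsup := fun q hq => by
    have hne : q ≠ p := ((Finset.mem_filter.1 hq).2).1
    exact hWle _ (by rw [dist_comm]; exact hsep q p hne)
  have hcard : (S.card : ℝ) ≤ (20 * R / 7 + 1) ^ 3 := by
    have h := card_le_of_separated_of_dist_le (S.image Y) (Y p) (r := 7 / 10) (by norm_num) hR ?_ ?_
    · rw [finrank_euclideanSpace_fin, Finset.card_image_of_injective _ hY] at h
      refine h.trans (le_of_eq ?_)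
      ring
    · intro c hc
      obtain ⟨q, hq, rfl⟩ := Finset.mem_image.1 hc
      exact ((Finset.mem_filter.1 hq).2).2
    · intro c hc d hd hcd
      obtain ⟨q, -, rfl⟩ := Finset.mem_image.1 hc
      obtain ⟨q', -, rfl⟩ := Finset.mem_image.1 hd
      exact hsep q q' fun h => hcd (by rw [h])
  calc W 0 + ∑ q ∈ S, W (dist (Y p) (Y q)) ≤ W 0 + ∑ _q ∈ S, Wsup := by linarith [Finset.sum_le_sum hterm]
    _ = W 0 + S.card * Wsup := by rw [Finset.sum_const, nsmul_eq_mul]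
    _ ≤ W 0 + (20 * R / 7 + 1) ^ 3 * Wsup := by nlinarith

/-! ## §4. Interior flags from the supercell motif's certified flags -/

/-- ★ **INTERIOR SITES INHERIT CAPPED GOODNESS**: if the centre of class `m` is `(η, D)`-capped-good in the supercell motif, then the interior block
site `(m, t)` is `η`-good in the block, read through any re-indexing `e` (`13/10·D + 1 ≤ ϱ`, `cB·(ϱ + diam) < k₀ + 1`). [folklore] -/
theorem goodAt_block_of_superMotif {N₀ M k₀ n N : ℕ} {x : Fin N₀ → E3} {a b : Fin 3 → E3} {cB ϱ diam η D : ℝ}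
    (hdual : ∀ j k, inner ℝ (b j) (a k) = if j = k then (1 : ℝ) else 0) (hb : ∀ j, ‖b j‖ ≤ cB)
    (hdiam : DiamLE x diam) (hk₀ : cB * (ϱ + diam) < k₀ + 1) {μ : Fin M → Fin N₀} {σ : Fin M → Fin 3 → ℤ}
    (hσ : ∀ q k, |σ q k| ≤ k₀) (hsup : ∀ (m : Fin N₀) (s : Fin 3 → ℤ), (∀ k, |s k| ≤ k₀) → ∃ q, μ q = m ∧ σ q = s)
    {cidx : Fin N₀ → Fin M} (hc : ∀ m, μ (cidx m) = m ∧ σ (cidx m) = 0) (hD : 13 / 10 * D + 1 ≤ ϱ)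
    (e : (Fin N₀ × (Fin 3 → Fin n)) ≃ Fin N) {t : Fin 3 → Fin n} (ht : Interior k₀ n t) {m : Fin N₀}
    (hgood : GoodAtScale η D (superMotif x a μ σ) (cidx m)) : GoodAt η (block x a n ∘ e.symm) (e (m, t)) := by
  have hz := goodAtScale_translate (latVec a (tvec t)) hgood
  refine goodAt_of_subconfig (ϱ := ϱ) ?_ ?_ ?_ hD hz
  · rintro _ ⟨q, rfl⟩
    rw [range_reindex]
    exact superMotif_add_mem_range_block x a hσ ht q
  · intro s hs hsd
    rw [range_reindex] at hs
    obtain ⟨p, rfl⟩ := hs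
    have hsd' : dist (block x a n p) (x m + latVec a (tvec t)) ≤ ϱ := by
      change dist (block x a n p) (block x a n (m, t)) ≤ ϱ
      simpa only [Function.comp_apply, Equiv.symm_apply_apply] using hsd
    exact mem_range_superMotif_add_of_dist_le hdual hb hdiam hk₀ hsup m hsd'
  · simp only [Function.comp_apply, Equiv.symm_apply_apply]
    exact superMotif_centre x a hc m t

/-- ★ **INTERIOR SITES INHERIT BADNESS**: if the centre of class `m` is NOT `(η, D)`-maybe-good in the supercell motif (`η ≤ 3/10`), then the
interior block site `(m, t)` is NOT `η`-good in the block. [folklore] -/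
theorem not_goodAt_block_of_superMotif {N₀ M k₀ n N : ℕ} {x : Fin N₀ → E3} {a b : Fin 3 → E3} {cB ϱ diam η D : ℝ}
    (hsep : PerSep x a) (hdual : ∀ j k, inner ℝ (b j) (a k) = if j = k then (1 : ℝ) else 0) (hb : ∀ j, ‖b j‖ ≤ cB)
    (hdiam : DiamLE x diam) (hk₀ : cB * (ϱ + diam) < k₀ + 1) {μ : Fin M → Fin N₀} {σ : Fin M → Fin 3 → ℤ}
    (hμσ : Function.Injective fun q => (μ q, σ q)) (hσ : ∀ q k, |σ q k| ≤ k₀)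
    (hsup : ∀ (m : Fin N₀) (s : Fin 3 → ℤ), (∀ k, |s k| ≤ k₀) → ∃ q, μ q = m ∧ σ q = s)
    {cidx : Fin N₀ → Fin M} (hc : ∀ m, μ (cidx m) = m ∧ σ (cidx m) = 0) (hD : 13 / 10 * D + 1 ≤ ϱ) (hη : η ≤ 3 / 10)
    (e : (Fin N₀ × (Fin 3 → Fin n)) ≃ Fin N) {t : Fin 3 → Fin n} (ht : Interior k₀ n t) {m : Fin N₀}
    (hbad : ¬ MaybeGoodAt η D (superMotif x a μ σ) (cidx m)) : ¬ GoodAt η (block x a n ∘ e.symm) (e (m, t)) := by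
  intro hg
  apply hbad
  rw [← maybeGoodAt_translate_iff (latVec a (tvec t))]
  have hzinj : Function.Injective fun q => superMotif x a μ σ q + latVec a (tvec t) :=
    fun q q' h => superMotif_injective hsep hμσ (add_right_cancel h)
  refine maybeGood_of_goodAt_subconfig (ϱ := ϱ) hzinj ?_ ?_ ?_ hD hη hg
  · rintro _ ⟨q, rfl⟩
    rw [range_reindex]
    exact superMotif_add_mem_range_block x a hσ ht q
  · intro s hs hsd
    rw [range_reindex] at hs
    obtain ⟨p, rfl⟩ := hs
    have hsd' : dist (block x a n p) (x m + latVec a (tvec t)) ≤ ϱ := by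
      change dist (block x a n p) (block x a n (m, t)) ≤ ϱ
      simpa only [Function.comp_apply, Equiv.symm_apply_apply] using hsd
    exact mem_range_superMotif_add_of_dist_le hdual hb hdiam hk₀ hsup m hsd'
  · simp only [Function.comp_apply, Equiv.symm_apply_apply]
    exact superMotif_centre x a hc m t

end Summit.AtomisticToContinuum.Crystallization.Theorems.FrustratedLawDichotomyPeriodicBlockKernel

end
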